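import Literature.Computability.MetaComplexity.ModTestProductParityClass
import HarnessLib

/-!
# Cell qa-qnc0, `p = 3` — ROUND-37P2 File B, STEP 3′ (part 1): the MOD-2–twisted character expansion of a product of
# MOD-3 tests over the cube, and Parseval on `ℤ/3` for sign tests

Planner qa-qnc0-p2 g37, ROUND-37P2 §2, STEP 3′ of Theorem 37.F′ — toolkit half (the count is in
`FibreDecimation37ParityCount.lean`).  Over the tree's `Literature/Computability/MetaComplexity/ModTestProductCubeSum.lean`,
`ModTestProductParityClass.lean` (the sign-twisted `L¹`/spread form; here the twist `t ∈ ℤ/2` is a parameter and the final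
bound is the Parseval form) and `TwoModuliExpSums.lean`:
* `norm_sum_prod_twist_le` — the character expansion of `Σ_u ∏_k h_k(ℓ_k(u))·χ₂(t)^{|u|}` (the MOD-2 twist is what selects a
  parity class of the cube), `≤ Σ_s (∏_k ‖a_{k,s_k}‖)·∏_i ‖1 + χ₃(λ(s)_i)χ₂(t)‖` (`TwoModuli.norm_cubeSum_eq`);
* `prod_norm_twist_le` — `∏_i ‖1 + χ₃(λ_i)χ₂(t)‖ ≤ 2^{|ι|}(√3/2)^{wt λ}` (`2cos(π/6) = √3`); `prod_norm_twist_zero` — it is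
  `0` for `λ = 0`, `t = 1` on a non-empty cube (`χ₂(1) = −1`, the tree's `ModTestProduct.stdAddChar_two_one`);
* `sum_norm_sq_fcoef_signTest` — Parseval on `ℤ/3` for a sign test (`1/9 + 4/9 + 4/9 = 1`, or `1 + 0 + 0` for a trivial
  test), `norm_fcoef_signTest_le_one`, `fcoef_signTest_empty` (a trivial test has no non-constant coefficients), `fcoef_const`.

Standard discrete Fourier analysis; the cell's packaging, not in print in this form.  WHAT THIS IS NOT: nothing about the game.
-/

noncomputable section

namespace Summit.QuantumAdvantage.AdviceFreeQNC0.Exp37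

open Finset ZMod
open Literature.Computability.MetaComplexity Literature.Computability.MetaComplexity.ModTestProduct
open Literature.Computability.MetaComplexity.TwoModuli

section Twist

variable {ι : Type*} [Fintype ι] [DecidableEq ι] {κ : Type*} [Fintype κ] [DecidableEq κ]

/-- An additive character turns sums into products. -/
private theorem map_sum_eq_prod {A R : Type*} [AddCommMonoid A] [CommMonoid R] (ψ : AddChar A R)
    (f : κ → A) : ψ (∑ k, f k) = ∏ k, ψ (f k) := by
  classical
  induction (univ : Finset κ) using Finset.induction_on with
  | empty => simp
  | insert j s hj ih => rw [sum_insert hj, prod_insert hj, AddChar.map_add_eq_mul, ih]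

/-- **Twisted character expansion**: with `h_k(v) = Σ_s a_{k,s} χ₃(sv)`,
`‖Σ_u ∏_k h_k(ℓ_k(u)) · χ₂(t)^{|u|}‖ ≤ Σ_s (∏_k ‖a_{k,s_k}‖) · ∏_i ‖1 + χ₃(λ(s)_i) χ₂(t)‖`. -/
theorem norm_sum_prod_twist_le (δ : κ → ι → ZMod 3) (a h : κ → ZMod 3 → ℂ)
    (hrep : ∀ k v, h k v = ∑ s : ZMod 3, a k s * stdAddChar (s * v)) (t : ZMod 2) :
    ‖∑ u : ι → Bool, (∏ k, h k (subsetSum (δ k) u)) *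
        (stdAddChar t : ℂ) ^ (univ.filter fun i => u i = true).card‖
      ≤ ∑ s : κ → ZMod 3, (∏ k, ‖a k (s k)‖) * ∏ i, ‖(1 : ℂ) + stdAddChar (combo δ s i) * stdAddChar t‖ := by
  classical
  have hexp : ∀ u : ι → Bool, ∏ k, h k (subsetSum (δ k) u)
      = ∑ s : κ → ZMod 3, (∏ k, a k (s k)) * (stdAddChar (subsetSum (combo δ s) u) : ℂ) := by
    intro u
    calc ∏ k, h k (subsetSum (δ k) u)
        = ∏ k, ∑ s : ZMod 3, a k s * (stdAddChar (s * subsetSum (δ k) u) : ℂ) :=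
          prod_congr rfl fun k _ => hrep k _
      _ = ∑ s : κ → ZMod 3, ∏ k, a k (s k) * (stdAddChar (s k * subsetSum (δ k) u) : ℂ) :=
          Fintype.prod_sum _
      _ = _ := by
          refine sum_congr rfl fun s _ => ?_
          rw [prod_mul_distrib, ← map_sum_eq_prod, sum_mul_subsetSum]
  have hterm : ∀ u : ι → Bool, (∏ k, h k (subsetSum (δ k) u)) *
      (stdAddChar t : ℂ) ^ (univ.filter fun i => u i = true).card =
      ∑ s : κ → ZMod 3, (∏ k, a k (s k)) * ((stdAddChar (subsetSum (combo δ s) u) : ℂ) *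
        (stdAddChar t : ℂ) ^ (univ.filter fun i => u i = true).card) := by
    intro u
    rw [hexp, sum_mul]
    exact sum_congr rfl fun s _ => by ring
  simp_rw [hterm]
  rw [sum_comm]
  simp_rw [← mul_sum]
  refine (norm_sum_le _ _).trans (sum_le_sum fun s _ => ?_)
  rw [norm_mul, Complex.norm_prod]
  refine mul_le_mul_of_nonneg_left (le_of_eq ?_) (prod_nonneg fun k _ => norm_nonneg _)
  exact norm_cubeSum_eq (combo δ s) t

omit [DecidableEq ι] [Fintype κ] [DecidableEq κ] in
/-- **Per-coordinate bound**: `∏_i ‖1 + χ₃(λ_i)χ₂(t)‖ ≤ 2^{|ι|}·(√3/2)^{wt λ}` (`‖1 + χ₃(j)χ₂(t)‖ ≤ 2cos(π/6) = √3` for `j ≠ 0`). -/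
theorem prod_norm_twist_le (lam : ι → ZMod 3) (t : ZMod 2) :
    ∏ i, ‖(1 : ℂ) + stdAddChar (lam i) * stdAddChar t‖ ≤
      (2 : ℝ) ^ Fintype.card ι * (Real.sqrt 3 / 2) ^ wt lam := by
  classical
  have hfac : ∀ i, ‖(1 : ℂ) + stdAddChar (lam i) * stdAddChar t‖ ≤
      if lam i ≠ 0 then Real.sqrt 3 else (2 : ℝ) := by
    intro i
    split_ifs with hi
    · have h := norm_one_add_stdAddChar_mul_stdAddChar_le (p := 3) (N := 2) (by decide) hi t
      have hcos : Real.cos (Real.pi / (3 * 2)) = Real.sqrt 3 / 2 := by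
        rw [show Real.pi / (3 * 2) = Real.pi / 6 by ring]; exact Real.cos_pi_div_six
      push_cast at h
      rw [hcos] at h
      linarith
    · calc ‖(1 : ℂ) + stdAddChar (lam i) * stdAddChar t‖ ≤ ‖(1 : ℂ)‖ + ‖(stdAddChar (lam i) : ℂ) * stdAddChar t‖ :=
            norm_add_le _ _
        _ = 2 := by
            rw [norm_mul, ZMod.stdAddChar_apply, ZMod.stdAddChar_apply, Circle.norm_coe, Circle.norm_coe]; norm_num
  calc ∏ i, ‖(1 : ℂ) + stdAddChar (lam i) * stdAddChar t‖
      ≤ ∏ i, (if lam i ≠ 0 then Real.sqrt 3 else (2 : ℝ)) :=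
        prod_le_prod (fun i _ => norm_nonneg _) fun i _ => hfac i
    _ = Real.sqrt 3 ^ wt lam * (2 : ℝ) ^ (univ.filter fun i => ¬ lam i ≠ 0).card := by
        rw [prod_ite, prod_const, prod_const]; rfl
    _ = (2 : ℝ) ^ Fintype.card ι * (Real.sqrt 3 / 2) ^ wt lam := by
        have hcard : (univ.filter fun i => ¬ lam i ≠ 0).card = Fintype.card ι - wt lam := by
          unfold wt
          have h := card_filter_add_card_filter_not (s := (univ : Finset ι)) (fun i => lam i ≠ 0)
          rw [card_univ] at h
          omega
        have hwt : wt lam ≤ Fintype.card ι := by unfold wt; exact card_le_univ _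
        rw [hcard, div_pow, pow_sub₀ _ (by norm_num : (2 : ℝ) ≠ 0) hwt]
        field_simp

omit [DecidableEq ι] [Fintype κ] [DecidableEq κ] in
/-- The twisted zero pattern vanishes on a non-empty cube: `∏_i ‖1 + χ₃(0)χ₂(1)‖ = 0`. -/
theorem prod_norm_twist_zero (hι : 0 < Fintype.card ι) :
    ∏ _i : ι, ‖(1 : ℂ) + stdAddChar (0 : ZMod 3) * stdAddChar (1 : ZMod 2)‖ = 0 := by
  obtain ⟨i⟩ := Fintype.card_pos_iff.1 hι
  refine prod_eq_zero (mem_univ i) ?_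
  rw [AddChar.map_zero_eq_one, one_mul, stdAddChar_two_one]; simp

end Twist

/-! ### Sign tests on `ℤ/3`: Parseval -/

section SignTests

/-- Orthogonality on `ℤ/3` in the form used by `fcoef`: `Σ_v χ₃(−(tv)) = 3·[t = 0]`. -/
theorem sum_stdAddChar_neg_mul' (t : ZMod 3) :
    ∑ v : ZMod 3, (stdAddChar (-(t * v)) : ℂ) = if t = 0 then 3 else 0 := by
  have h := Literature.Analysis.Fourier.sum_stdAddChar_mul (N := 3) (-t)
  simp only [neg_eq_zero, Nat.cast_ofNat] at h
  rw [← h]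
  exact sum_congr rfl fun v _ => by rw [neg_mul]

/-- Fourier coefficients of a constant: `a_0 = c`, `a_t = 0` (`t ≠ 0`). -/
theorem fcoef_const (c : ℂ) (t : ZMod 3) : fcoef (fun _ => c) t = if t = 0 then c else 0 := by
  unfold fcoef
  rw [← mul_sum, sum_stdAddChar_neg_mul']
  split_ifs <;> ring

/-- A trivial test (`A = ∅` or `A = ℤ/3`) is a constant sign. -/
theorem signTest_const_of {A : Finset (ZMod 3)} (h : ¬ (A.Nonempty ∧ A ≠ univ)) :
    ∃ c : ℂ, (c = 1 ∨ c = -1) ∧ signTest A = fun _ => c := by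
  by_cases hA : A.Nonempty
  · have hu : A = univ := by
      by_contra hne; exact h ⟨hA, hne⟩
    refine ⟨-1, Or.inr rfl, funext fun v => ?_⟩
    unfold signTest; rw [if_pos (by rw [hu]; exact mem_univ v)]
  · rw [not_nonempty_iff_eq_empty] at hA
    refine ⟨1, Or.inl rfl, funext fun v => ?_⟩
    unfold signTest; rw [if_neg (by rw [hA]; exact notMem_empty v)]

/-- Sign tests are `±1`-valued. -/
theorem signTest_sign' (A : Finset (ZMod 3)) (v : ZMod 3) : signTest A v = 1 ∨ signTest A v = -1 := by
  unfold signTest; split_ifs <;> simp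

/-- A proper non-empty accepting set gives a non-constant sign test. -/
theorem signTest_nonconst' {A : Finset (ZMod 3)} (hA : A.Nonempty) (hA' : A ≠ univ) :
    ∃ v w, signTest A v ≠ signTest A w := by
  obtain ⟨v, hv⟩ := hA
  obtain ⟨w, -, hw⟩ : ∃ w ∈ (univ : Finset (ZMod 3)), w ∉ A := by
    by_contra hall
    push Not at hall
    exact hA' (eq_univ_of_forall fun w => hall w (mem_univ w))
  refine ⟨v, w, ?_⟩
  unfold signTest
  rw [if_pos hv, if_neg hw]
  norm_num

/-- **Parseval on `ℤ/3` for a sign test**: `Σ_t ‖a_t‖² = 1`. -/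
theorem sum_norm_sq_fcoef_signTest (A : Finset (ZMod 3)) : ∑ t : ZMod 3, ‖fcoef (signTest A) t‖ ^ 2 = 1 := by
  rw [show (∑ t : ZMod 3, ‖fcoef (signTest A) t‖ ^ 2) =
      ‖fcoef (signTest A) 0‖ ^ 2 + ‖fcoef (signTest A) 1‖ ^ 2 + ‖fcoef (signTest A) 2‖ ^ 2 from Fin.sum_univ_three _]
  by_cases h : A.Nonempty ∧ A ≠ univ
  · rw [fcoef_sign_norm_zero _ (signTest_sign' A) (signTest_nonconst' h.1 h.2),
      fcoef_sign_norm_ne_zero _ (signTest_sign' A) (signTest_nonconst' h.1 h.2) (by decide),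
      fcoef_sign_norm_ne_zero _ (signTest_sign' A) (signTest_nonconst' h.1 h.2) (by decide)]
    norm_num
  · obtain ⟨c, hc, hA⟩ := signTest_const_of h
    rw [hA, fcoef_const, fcoef_const, fcoef_const, if_pos rfl, if_neg (by decide), if_neg (by decide)]
    rcases hc with rfl | rfl <;> simp

/-- Every Fourier coefficient of a sign test has norm `≤ 1`. -/
theorem norm_fcoef_signTest_le_one (A : Finset (ZMod 3)) (t : ZMod 3) : ‖fcoef (signTest A) t‖ ≤ 1 := by
  have h : ‖fcoef (signTest A) t‖ ^ 2 ≤ 1 := by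
    rw [← sum_norm_sq_fcoef_signTest A]
    exact single_le_sum (f := fun t => ‖fcoef (signTest A) t‖ ^ 2) (fun t _ => sq_nonneg _) (mem_univ t)
  exact (pow_le_one_iff_of_nonneg (norm_nonneg _) two_ne_zero).1 h

/-- The trivial test `A = ∅` has no non-constant Fourier coefficients. -/
theorem fcoef_signTest_empty {t : ZMod 3} (ht : t ≠ 0) : fcoef (signTest (∅ : Finset (ZMod 3))) t = 0 := by
  have e : signTest (∅ : Finset (ZMod 3)) = fun _ => (1 : ℂ) := by
    funext v; unfold signTest; rw [if_neg (notMem_empty v)]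
  rw [e, fcoef_const, if_neg ht]

end SignTests


end Summit.QuantumAdvantage.AdviceFreeQNC0.Exp37

end
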